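/-
Origin: expansion seat `planner-pub-hodgecm-pv09-0`, handover 2026-08-18T03:42:11Z (`HOME/pub-hodgecm-pv09/lean/Pv09/Spectral.lean`, md5 fb7bf509, 161 lines);
landed by the gen-5 packager in gate run 19 as `HodgeCM/PerL34/Spectral.lean` (verbatim).
-/
/-
pub-hodgecm speedrun cell, prover pv09 — WIP module `Pv09.Spectral` (landing target `HodgeCM/PerL34/Spectral.lean`).
Imports: Mathlib only.  KERNEL core of DAG node N22 (PerL v5 §3.3 spectral paragraph, tex ll. 384–396), clause
(l. 386–387): "the orthogonal projection e_σ̂ onto σ̂ lies in the von Neumann algebra generated by R(U(W)(𝔸)),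
hence preserves every closed R(U(W)(𝔸))-invariant subspace."

What is proved here, for ANY group `G` acting unitarily (`R : G →* (H →L[ℂ] H)`, `⟪R g u, R g v⟫ = ⟪u, v⟫`) on a
complex Hilbert space `H`:
* `starProjection_mem_commutant` — the orthogonal projection onto a closed `R`-invariant subspace `M` commutes
  with every `R g` (because `Mᗮ` is invariant too: `(R g)† = R g⁻¹`);
* `preserves_of_mem_bicommutant` — "hence": any operator in the BICOMMUTANT `R(G)″` (= the von Neumann algebra
  generated by `R(G)`, von Neumann's density theorem being the usual bridge; we work with `R(G)″` directly, which is
  what the argument uses) preserves every closed `R`-invariant subspace;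
* `starProjection_mem_bicommutant` — the projection onto a closed subspace `σ̂` that is stable under the COMMUTANT
  `R(G)′` lies in `R(G)″`.  Stability under `R(G)′` is the characteristic property of an ISOTYPIC component
  (l. 385: σ̂ = the isotypic components of L²([U(W)])), and is the only representation-theoretic input;
* `isotypic_projection_preserves` — the two combined: e_σ̂ preserves every closed invariant subspace.
The interface corollary for the carver's typed `HodgeCM.PerL34.N22_spectral` is in `Pv09.SpectralN22`.
-/
import Mathlib.Analysis.InnerProductSpace.Projection.Basic
import Mathlib.Analysis.InnerProductSpace.Adjoint
import Literature.RepresentationTheory.Unitary.InvariantSubspaceBicommutant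

/-! PORT of `HodgeCM/PerL34/Spectral.lean` (HodgeCMPerL run 82) — verbatim mechanical port; provenance in the PORT header line. -/

set_option autoImplicit false

open scoped InnerProductSpace
open ContinuousLinearMap

namespace HodgeCM.PerL34.Spectral

variable {H : Type*} [NormedAddCommGroup H] [InnerProductSpace ℂ H]

/-- A set `S` of bounded operators is *adjoint-closed* in the weak sense used here: every `A ∈ S` has a formal
adjoint inside `S`.  (No completeness needed to state it; for a unitary representation `(R g)† = R g⁻¹`.) -/
def AdjointClosed (S : Set (H →L[ℂ] H)) : Prop :=
  ∀ A ∈ S, ∃ B ∈ S, ∀ u v : H, ⟪A u, v⟫_ℂ = ⟪u, B v⟫_ℂ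

/-- `S`-invariance of a submodule. -/
def Invariant (S : Set (H →L[ℂ] H)) (M : Submodule ℂ H) : Prop := ∀ A ∈ S, ∀ v ∈ M, A v ∈ M

/-- If `M` is invariant under an adjoint-closed set of operators, so is `Mᗮ`. -/
theorem invariant_orthogonal {S : Set (H →L[ℂ] H)} (hS : AdjointClosed S) {M : Submodule ℂ H}
    (hM : Invariant S M) : Invariant S Mᗮ := by
  intro A hA v hv
  rw [Submodule.mem_orthogonal] at hv ⊢
  intro m hm
  obtain ⟨B, hB, hAB⟩ := hS A hA
  -- ⟪m, A v⟫ = conj ⟪A v, m⟫ = conj ⟪v, B m⟫ = ⟪B m, v⟫ = 0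
  rw [← inner_conj_symm, hAB, inner_conj_symm]
  exact hv (B m) (hM B hB m hm)

/-- The orthogonal projection onto `M` commutes with an operator leaving both `M` and `Mᗮ` invariant. -/
alias starProjection_commute := Literature.RepresentationTheory.Unitary.starProjection_commute

/-- The orthogonal projection onto a closed `S`-invariant subspace lies in the commutant `S′`
(`S` adjoint-closed). -/
theorem starProjection_mem_commutant {S : Set (H →L[ℂ] H)} (hS : AdjointClosed S) {M : Submodule ℂ H}
    [M.HasOrthogonalProjection] (hM : Invariant S M) :
    M.starProjection ∈ Set.centralizer S := by
  intro A hA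
  exact starProjection_commute (hM A hA) (invariant_orthogonal hS hM A hA)

/-- **"hence preserves every closed invariant subspace"** (tex l. 387): an operator in the bicommutant `S″` of an
adjoint-closed set `S` preserves every closed (`HasOrthogonalProjection`) `S`-invariant subspace. -/
theorem preserves_of_mem_bicommutant {S : Set (H →L[ℂ] H)} (hS : AdjointClosed S) {e : H →L[ℂ] H}
    (he : e ∈ Set.centralizer (Set.centralizer S)) {M : Submodule ℂ H} [M.HasOrthogonalProjection]
    (hM : Invariant S M) : ∀ v ∈ M, e v ∈ M := by
  intro v hv
  have hcomm : M.starProjection * e = e * M.starProjection := he _ (starProjection_mem_commutant hS hM)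
  have : e v = M.starProjection (e v) := by
    have h := congrArg (fun T : H →L[ℂ] H => T v) hcomm
    simp only [mul_apply_eq_comp] at h
    rw [Submodule.starProjection_eq_self_iff.mpr hv] at h
    exact h.symm
  rw [this]
  exact M.starProjection_apply_mem _

section unitary

variable {G : Type*} [Group G]

/-- A unitary representation: a homomorphism into bounded operators preserving the inner product
(the shape of the frozen interface field `IsolationCore.R_unitary`). -/
def IsUnitaryRep (R : G →* (H →L[ℂ] H)) : Prop := ∀ (g : G) (u v : H), ⟪R g u, R g v⟫_ℂ = ⟪u, v⟫_ℂ

/-- (Ported verbatim from the HodgeCMPerL package; no docstring in the source.) -/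
theorem IsUnitaryRep.inner_apply_left {R : G →* (H →L[ℂ] H)} (hR : IsUnitaryRep R) (g : G) (u v : H) :
    ⟪R g u, v⟫_ℂ = ⟪u, R g⁻¹ v⟫_ℂ := by
  conv_lhs => rw [show v = R g (R g⁻¹ v) by
    rw [← mul_apply_eq_comp, ← map_mul, mul_inv_cancel, map_one]; rfl]
  exact hR g u _

/-- The range of a unitary representation is adjoint-closed: `(R g)† = R g⁻¹`. -/
theorem IsUnitaryRep.adjointClosed {R : G →* (H →L[ℂ] H)} (hR : IsUnitaryRep R) :
    AdjointClosed (Set.range R) := by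
  rintro _ ⟨g, rfl⟩
  exact ⟨R g⁻¹, ⟨g⁻¹, rfl⟩, hR.inner_apply_left g⟩

/-- For a unitary representation, `R`-invariance in the interface's form is `Invariant (range R)`. -/
theorem invariant_range_iff {R : G →* (H →L[ℂ] H)} {M : Submodule ℂ H} :
    Invariant (Set.range R) M ↔ ∀ g : G, ∀ v ∈ M, R g v ∈ M := by
  constructor
  · intro h g v hv; exact h (R g) ⟨g, rfl⟩ v hv
  · rintro h _ ⟨g, rfl⟩ v hv; exact h g v hv

/-- **N22, clause l. 386–387, KERNEL form**: an operator in the bicommutant `R(G)″` of a unitary representation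
preserves every closed `R(G)`-invariant subspace. -/
theorem preserves_of_mem_bicommutant_range {R : G →* (H →L[ℂ] H)} (hR : IsUnitaryRep R) {e : H →L[ℂ] H}
    (he : e ∈ Set.centralizer (Set.centralizer (Set.range R))) (M : Submodule ℂ H)
    [M.HasOrthogonalProjection] (hM : ∀ g : G, ∀ v ∈ M, R g v ∈ M) : ∀ v ∈ M, e v ∈ M :=
  preserves_of_mem_bicommutant hR.adjointClosed he (invariant_range_iff.mpr hM)

variable [CompleteSpace H]

/-- The commutant of the range of a unitary representation is closed under Hilbert-space adjoints. -/
theorem adjoint_mem_commutant {R : G →* (H →L[ℂ] H)} (hR : IsUnitaryRep R) {A : H →L[ℂ] H}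
    (hA : A ∈ Set.centralizer (Set.range R)) : adjoint A ∈ Set.centralizer (Set.range R) := by
  rintro _ ⟨g, rfl⟩
  -- adjoint (R g) = R g⁻¹, and A commutes with R g⁻¹
  have hadj : ∀ h : G, adjoint (R h) = R h⁻¹ := fun h =>
    (ContinuousLinearMap.eq_adjoint_iff _ _).mpr (fun x y => by rw [hR.inner_apply_left, inv_inv]) |>.symm
  have hc : R g⁻¹ * A = A * R g⁻¹ := hA (R g⁻¹) ⟨g⁻¹, rfl⟩
  have := congrArg adjoint hc
  rw [← ContinuousLinearMap.star_eq_adjoint, ← ContinuousLinearMap.star_eq_adjoint, star_mul, star_mul,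
    ContinuousLinearMap.star_eq_adjoint, ContinuousLinearMap.star_eq_adjoint, hadj, inv_inv] at this
  exact this.symm

/-- The commutant `R(G)′` of a unitary representation is adjoint-closed. -/
theorem adjointClosed_commutant {R : G →* (H →L[ℂ] H)} (hR : IsUnitaryRep R) :
    AdjointClosed (Set.centralizer (Set.range R)) := fun A hA =>
  ⟨adjoint A, adjoint_mem_commutant hR hA, fun u v => (ContinuousLinearMap.adjoint_inner_right A u v).symm⟩

/-- **Isotypic projections lie in `R(G)″`** (tex l. 386 "lies in the von Neumann algebra generated by
R(U(W)(𝔸))"): if the closed subspace `σ̂` is stable under the commutant `R(G)′` — the characteristic property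
of an isotypic component — then its orthogonal projection commutes with `R(G)′`. -/
theorem starProjection_mem_bicommutant {R : G →* (H →L[ℂ] H)} (hR : IsUnitaryRep R) (σ : Submodule ℂ H)
    [σ.HasOrthogonalProjection]
    (hσ : ∀ A ∈ Set.centralizer (Set.range R), ∀ x ∈ σ, A x ∈ σ) :
    σ.starProjection ∈ Set.centralizer (Set.centralizer (Set.range R)) :=
  starProjection_mem_commutant (adjointClosed_commutant hR) hσ

/-- **N22 clause (l. 386–387) assembled**: for a unitary representation `R` and a closed subspace `σ̂` stable
under the commutant `R(G)′`, the orthogonal projection `e_σ̂` preserves every closed `R(G)`-invariant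
subspace `M`. -/
theorem isotypic_projection_preserves {R : G →* (H →L[ℂ] H)} (hR : IsUnitaryRep R) (σ : Submodule ℂ H)
    [σ.HasOrthogonalProjection] (hσ : ∀ A ∈ Set.centralizer (Set.range R), ∀ x ∈ σ, A x ∈ σ)
    (M : Submodule ℂ H) [M.HasOrthogonalProjection] (hM : ∀ g : G, ∀ v ∈ M, R g v ∈ M) :
    ∀ v ∈ M, σ.starProjection v ∈ M :=
  preserves_of_mem_bicommutant_range hR (starProjection_mem_bicommutant hR σ hσ) M hM

end unitary

end HodgeCM.PerL34.Spectral
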